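import Summits.HubbardSuperconductivity.HubbardSuperconductivity.Theorems.NodalDiracTwistNodalDiracWeakCouplingConeEnergyCore

/-!
# Route `NodalDiracTwist` — crux `NodalDiracWeakCoupling`: first-order energy estimates, the ray

Helper file for stmt-HubbardSuperconductivity-10370 (`NodalDiracWeakCoupling`), supporting the
stub `stub_coneEnergy` of the line `birth`; continues
`NodalDiracTwistNodalDiracWeakCouplingConeEnergyCore`. Instantiates the abstract two-sided
first-order estimate `core_estimate` (Kato, *Perturbation Theory for Linear Operators* (1966),
II §5, elementary form) along a ray `φ = p + r u` (`u` a unit direction) of a family `H φ` with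
first-order data `V 0, V 1` at `p`: `A = H p`, `W = V_u = u₀ V 0 + u₁ V 1` (form bound `2C`,
`dir_form_bound`), `R = H(p + ru) - H p - r V_u` (form bound `ε r` for `r ≤ δ(ε)` by the
sesquilinear Taylor hypothesis, `dir_remainder_bound`). Result `cone_line_core`: for a unit
sector ground state `ψ` at `p + r u` with frame weights `c_k = ⟨e_k, ψ⟩` and
`t = √(1 - |c₁|² - |c₂|²)`, (1) `g t² + r D(c) ≤ 2εr + 8 C r t` and (2) every unit test vector of
the ground plane has energy `≤ minEnergyOn + 2ρ r + 2ε r + 8 C r t`. Also the arithmetic of the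
error term `8 C t` (`eight_mul_le_half`). No new definitions.
-/

-- the mandated namespace `Summit.<Summit>.<Problem>.Theorems` repeats `HubbardSuperconductivity`
-- (single-problem summit, D-0017), which the `dupNamespace` linter flags on every declaration
set_option linter.dupNamespace false

namespace Summit.HubbardSuperconductivity.HubbardSuperconductivity.Theorems.NodalDiracTwist

open Matrix Complex Literature.MathematicalPhysics.QuantumLattice
open scoped ComplexOrder

variable {ι : Type*} [Fintype ι]

/-! ### Arithmetic of the error terms -/

/-- If `t² ≤ θ ≤ η² / (256 C² + 1)` and `η ≥ 0` then `8 C t ≤ η / 2`. [folklore] -/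
theorem eight_mul_le_half {C t θ η : ℝ} (ht2 : t ^ 2 ≤ θ) (hθ : θ ≤ η ^ 2 / (256 * C ^ 2 + 1))
    (hη : 0 ≤ η) : 8 * C * t ≤ η / 2 := by
  have hsq : (8 * C * t) ^ 2 ≤ (η / 2) ^ 2 := by
    have h64 : (8 * C * t) ^ 2 = 64 * C ^ 2 * t ^ 2 := by ring
    rw [h64]
    have hC2 : 0 ≤ 64 * C ^ 2 := by positivity
    have hA : 64 * C ^ 2 * t ^ 2 ≤ 64 * C ^ 2 * θ := mul_le_mul_of_nonneg_left ht2 hC2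
    have hA' : 64 * C ^ 2 * θ ≤ 64 * C ^ 2 * (η ^ 2 / (256 * C ^ 2 + 1)) :=
      mul_le_mul_of_nonneg_left hθ hC2
    have hB : 64 * C ^ 2 * (η ^ 2 / (256 * C ^ 2 + 1)) ≤ (η / 2) ^ 2 := by
      rw [mul_div_assoc', div_le_iff₀ (by positivity)]
      nlinarith [sq_nonneg η, sq_nonneg C]
    exact hA.trans (hA'.trans hB)
  exact (abs_le_of_sq_le_sq' hsq (by positivity)).2

/-! ### The ray `p + r u`: form bounds for `V_u` and the Taylor remainder -/

/-- The components of a unit direction are bounded by `1`. [folklore] -/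
theorem abs_dir_le_one {u : Fin 2 → ℝ} (hu : u 0 ^ 2 + u 1 ^ 2 = 1) : |u 0| ≤ 1 ∧ |u 1| ≤ 1 := by
  constructor
  · rw [← sq_le_one_iff_abs_le_one]; nlinarith [sq_nonneg (u 1)]
  · rw [← sq_le_one_iff_abs_le_one]; nlinarith [sq_nonneg (u 0)]

/-- `V_u = u₀ V 0 + u₁ V 1` has form bound `2C` on unit vectors. [folklore] -/
theorem dir_form_bound (V : Fin 2 → Matrix ι ι ℂ) {C : ℝ}
    (hCV : ∀ (μ : Fin 2) (x w : ι → ℂ), star x ⬝ᵥ x = 1 → star w ⬝ᵥ w = 1 →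
      ‖star x ⬝ᵥ (V μ *ᵥ w)‖ ≤ C) {u : Fin 2 → ℝ} (hu : u 0 ^ 2 + u 1 ^ 2 = 1)
    (x w : ι → ℂ) (hx : star x ⬝ᵥ x = 1) (hw : star w ⬝ᵥ w = 1) :
    ‖star x ⬝ᵥ (((u 0 : ℝ) : ℂ) • V 0 + ((u 1 : ℝ) : ℂ) • V 1) *ᵥ w‖ ≤ 2 * C := by
  obtain ⟨h0, h1⟩ := abs_dir_le_one hu
  rw [add_mulVec, smul_mulVec, smul_mulVec, dotProduct_add, dotProduct_smul, dotProduct_smul,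
    smul_eq_mul, smul_eq_mul]
  refine (norm_add_le _ _).trans ?_
  rw [norm_mul, norm_mul, Complex.norm_real, Complex.norm_real, Real.norm_eq_abs,
    Real.norm_eq_abs]
  have h0' := hCV 0 x w hx hw
  have h1' := hCV 1 x w hx hw
  nlinarith [abs_nonneg (u 0), abs_nonneg (u 1), norm_nonneg (star x ⬝ᵥ V 0 *ᵥ w),
    norm_nonneg (star x ⬝ᵥ V 1 *ᵥ w)]

omit [Fintype ι] in
/-- Along the ray, `r V_u = (r u₀) V 0 + (r u₁) V 1`. [folklore] -/
theorem dir_smul (V : Fin 2 → Matrix ι ι ℂ) (r : ℝ) (u : Fin 2 → ℝ) :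
    (r : ℂ) • (((u 0 : ℝ) : ℂ) • V 0 + ((u 1 : ℝ) : ℂ) • V 1) =
      ((r * u 0 : ℝ) : ℂ) • V 0 + ((r * u 1 : ℝ) : ℂ) • V 1 := by
  rw [smul_add, smul_smul, smul_smul, Complex.ofReal_mul, Complex.ofReal_mul]

/-- The Taylor remainder `R = H(p + ru) - H p - r V_u` has form bound `ε r` on unit vectors once
`r ≤ δ(ε)`. [folklore] -/
theorem dir_remainder_bound (H : (Fin 2 → ℝ) → Matrix ι ι ℂ) (p : Fin 2 → ℝ)
    (V : Fin 2 → Matrix ι ι ℂ) {ε δ : ℝ}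
    (hδ : ∀ y : Fin 2 → ℝ, Real.sqrt (y 0 ^ 2 + y 1 ^ 2) ≤ δ → ∀ x w : ι → ℂ,
      star x ⬝ᵥ x = 1 → star w ⬝ᵥ w = 1 →
        ‖star x ⬝ᵥ ((H (fun ν => p ν + y ν) - H p -
            (((y 0 : ℝ) : ℂ) • V 0 + ((y 1 : ℝ) : ℂ) • V 1)) *ᵥ w)‖ ≤
          ε * Real.sqrt (y 0 ^ 2 + y 1 ^ 2))
    {r : ℝ} (hr : 0 < r) (hrδ : r ≤ δ) {u : Fin 2 → ℝ} (hu : u 0 ^ 2 + u 1 ^ 2 = 1)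
    (x w : ι → ℂ) (hx : star x ⬝ᵥ x = 1) (hw : star w ⬝ᵥ w = 1) :
    ‖star x ⬝ᵥ (H (fun ν => p ν + r * u ν) - H p -
        (r : ℂ) • (((u 0 : ℝ) : ℂ) • V 0 + ((u 1 : ℝ) : ℂ) • V 1)) *ᵥ w‖ ≤ ε * r := by
  have hnorm : Real.sqrt ((r * u 0) ^ 2 + (r * u 1) ^ 2) = r := by
    rw [show (r * u 0) ^ 2 + (r * u 1) ^ 2 = r ^ 2 by linear_combination r ^ 2 * hu,
      Real.sqrt_sq hr.le]
  have h : ‖star x ⬝ᵥ ((H (fun ν => p ν + r * u ν) - H p -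
      (((r * u 0 : ℝ) : ℂ) • V 0 + ((r * u 1 : ℝ) : ℂ) • V 1)) *ᵥ w)‖ ≤
      ε * Real.sqrt ((r * u 0) ^ 2 + (r * u 1) ^ 2) :=
    hδ (fun ν => r * u ν) (hnorm.le.trans hrδ) x w hx hw
  rw [hnorm] at h
  rwa [dir_smul]

/-- The squared distance of `p + r u` from `p` is `r²`. [folklore] -/
theorem dir_dist_sq (p : Fin 2 → ℝ) (r : ℝ) {u : Fin 2 → ℝ} (hu : u 0 ^ 2 + u 1 ^ 2 = 1) :
    (p 0 + r * u 0 - p 0) ^ 2 + (p 1 + r * u 1 - p 1) ^ 2 = r ^ 2 := by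
  linear_combination r ^ 2 * hu

/-! ### The core estimate along the ray -/

/-- **The two-sided first-order estimate along the ray `p + r u`** (`core_estimate` with
`A = H p`, `W = V_u`, `R = H(p + ru) - H p - r V_u`): for `0 < r ≤ δ(ε)`, a unit direction `u`
and a unit sector ground state `ψ` at `p + r u` with `c_k = ⟨e_k, ψ⟩`,
`t = √(1 - |c₁|² - |c₂|²)`: (1) `g t² + r D(c) ≤ 2εr + 8 C r t`; (2) every unit test vector
`x₁e₁ + x₂e₂` has energy `≤ minEnergyOn + 2ρr + 2εr + 8 C r t`. [folklore] -/
theorem cone_line_core {ι : Type*} [Fintype ι] (K : Submodule ℂ (ι → ℂ))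
    (H : (Fin 2 → ℝ) → Matrix ι ι ℂ) (p : Fin 2 → ℝ) (hHerm : (H p).IsHermitian)
    (hlb : ∀ φ, ∀ v ∈ K, star v ⬝ᵥ v = 1 → (H φ).minEnergyOn K ≤ (star v ⬝ᵥ H φ *ᵥ v).re)
    (V : Fin 2 → Matrix ι ι ℂ) {C : ℝ} (hC : 0 ≤ C)
    (hCV : ∀ (μ : Fin 2) (x w : ι → ℂ), star x ⬝ᵥ x = 1 → star w ⬝ᵥ w = 1 →
      ‖star x ⬝ᵥ (V μ *ᵥ w)‖ ≤ C)
    {e₁ e₂ : ι → ℂ} (he₁K : e₁ ∈ K) (he₂K : e₂ ∈ K) (he₁ : star e₁ ⬝ᵥ e₁ = 1)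
    (he₂ : star e₂ ⬝ᵥ e₂ = 1) (he₁₂ : star e₁ ⬝ᵥ e₂ = 0)
    (hHe₁ : H p *ᵥ e₁ = (((H p).minEnergyOn K : ℝ) : ℂ) • e₁)
    (hHe₂ : H p *ᵥ e₂ = (((H p).minEnergyOn K : ℝ) : ℂ) • e₂) {g : ℝ} (hg : 0 ≤ g)
    (hgap : ∀ χ ∈ K, star e₁ ⬝ᵥ χ = 0 → star e₂ ⬝ᵥ χ = 0 → star χ ⬝ᵥ χ = 1 →
      (H p).minEnergyOn K + g ≤ (star χ ⬝ᵥ H p *ᵥ χ).re)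
    {ε δ : ℝ}
    (hδ : ∀ y : Fin 2 → ℝ, Real.sqrt (y 0 ^ 2 + y 1 ^ 2) ≤ δ → ∀ x w : ι → ℂ,
      star x ⬝ᵥ x = 1 → star w ⬝ᵥ w = 1 →
        ‖star x ⬝ᵥ ((H (fun ν => p ν + y ν) - H p -
            (((y 0 : ℝ) : ℂ) • V 0 + ((y 1 : ℝ) : ℂ) • V 1)) *ᵥ w)‖ ≤
          ε * Real.sqrt (y 0 ^ 2 + y 1 ^ 2))
    {r : ℝ} (hr : 0 < r) (hrδ : r ≤ δ) {u : Fin 2 → ℝ} (hu : u 0 ^ 2 + u 1 ^ 2 = 1)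
    {a : ℝ} {b : ℂ}
    (ha : a = ((star e₁ ⬝ᵥ ((((u 0 : ℝ) : ℂ) • V 0 + ((u 1 : ℝ) : ℂ) • V 1) *ᵥ e₁)).re -
      (star e₂ ⬝ᵥ ((((u 0 : ℝ) : ℂ) • V 0 + ((u 1 : ℝ) : ℂ) • V 1) *ᵥ e₂)).re) / 2)
    (hb : b = (star e₁ ⬝ᵥ ((((u 0 : ℝ) : ℂ) • V 0 + ((u 1 : ℝ) : ℂ) • V 1) *ᵥ e₂) +
      star (star e₂ ⬝ᵥ ((((u 0 : ℝ) : ℂ) • V 0 + ((u 1 : ℝ) : ℂ) • V 1) *ᵥ e₁))) / 2)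
    {ψ : ι → ℂ}
    (hψ : ψ ∈ K ∧ ψ ≠ 0 ∧ H (fun ν => p ν + r * u ν) *ᵥ ψ =
      (((H (fun ν => p ν + r * u ν)).minEnergyOn K : ℝ) : ℂ) • ψ)
    (hψ1 : star ψ ⬝ᵥ ψ = 1) :
    (g * (1 - ‖star e₁ ⬝ᵥ ψ‖ ^ 2 - ‖star e₂ ⬝ᵥ ψ‖ ^ 2) +
        r * (Real.sqrt (a ^ 2 + ‖b‖ ^ 2) * (‖star e₁ ⬝ᵥ ψ‖ ^ 2 + ‖star e₂ ⬝ᵥ ψ‖ ^ 2) +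
          a * (‖star e₁ ⬝ᵥ ψ‖ ^ 2 - ‖star e₂ ⬝ᵥ ψ‖ ^ 2) +
          2 * (starRingEnd ℂ (star e₁ ⬝ᵥ ψ) * (star e₂ ⬝ᵥ ψ) * b).re) ≤
      2 * (ε * r) + 4 * (2 * C) * r * Real.sqrt (1 - ‖star e₁ ⬝ᵥ ψ‖ ^ 2 - ‖star e₂ ⬝ᵥ ψ‖ ^ 2)) ∧
    ∀ x₁ x₂ : ℂ, ‖x₁‖ ^ 2 + ‖x₂‖ ^ 2 = 1 →
      (star (x₁ • e₁ + x₂ • e₂) ⬝ᵥ H (fun ν => p ν + r * u ν) *ᵥ (x₁ • e₁ + x₂ • e₂)).re ≤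
        (H (fun ν => p ν + r * u ν)).minEnergyOn K + 2 * Real.sqrt (a ^ 2 + ‖b‖ ^ 2) * r +
          2 * (ε * r) +
          4 * (2 * C) * r * Real.sqrt (1 - ‖star e₁ ⬝ᵥ ψ‖ ^ 2 - ‖star e₂ ⬝ᵥ ψ‖ ^ 2) := by
  obtain ⟨hψK, -, hHψ⟩ := hψ
  have hW := dir_form_bound V hCV hu
  have hR := dir_remainder_bound H p V hδ hr hrδ hu
  have hB : H p + (r : ℂ) • (((u 0 : ℝ) : ℂ) • V 0 + ((u 1 : ℝ) : ℂ) • V 1) +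
      (H (fun ν => p ν + r * u ν) - H p -
        (r : ℂ) • (((u 0 : ℝ) : ℂ) • V 0 + ((u 1 : ℝ) : ℂ) • V 1)) =
      H (fun ν => p ν + r * u ν) := by
    abel
  have hlb' : ∀ v ∈ K, star v ⬝ᵥ v = 1 → (H (fun ν => p ν + r * u ν)).minEnergyOn K ≤
      (star v ⬝ᵥ (H p + (r : ℂ) • (((u 0 : ℝ) : ℂ) • V 0 + ((u 1 : ℝ) : ℂ) • V 1) +
        (H (fun ν => p ν + r * u ν) - H p -
          (r : ℂ) • (((u 0 : ℝ) : ℂ) • V 0 + ((u 1 : ℝ) : ℂ) • V 1))) *ᵥ v).re := by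
    rw [hB]
    exact hlb _
  have hψE : (star ψ ⬝ᵥ (H p + (r : ℂ) • (((u 0 : ℝ) : ℂ) • V 0 + ((u 1 : ℝ) : ℂ) • V 1) +
      (H (fun ν => p ν + r * u ν) - H p -
        (r : ℂ) • (((u 0 : ℝ) : ℂ) • V 0 + ((u 1 : ℝ) : ℂ) • V 1))) *ᵥ ψ).re =
      (H (fun ν => p ν + r * u ν)).minEnergyOn K := by
    rw [hB, hHψ, dotProduct_smul, hψ1, smul_eq_mul, mul_one, Complex.ofReal_re]
  have h := core_estimate K hHerm hg hr.le (by positivity : (0 : ℝ) ≤ 2 * C) he₁K he₂K he₁ he₂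
    he₁₂ hHe₁ hHe₂ hgap hW hR hlb' hψK hψ1 hψE ha hb
  rw [hB] at h
  exact h

end Summit.HubbardSuperconductivity.HubbardSuperconductivity.Theorems.NodalDiracTwist
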